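import Mathlib
import HarnessLib
import Summits.NavierStokesRegularity.NavierStokesRegularity.Theses.PoloidalWindowDoor
import Summits.NavierStokesRegularity.NavierStokesRegularity.Theorems.PoloidalWindowDoorPoloidalWindowRigidityEntireGerm
import Summits.NavierStokesRegularity.NavierStokesRegularity.Theorems.PoloidalWindowDoorPoloidalWindowRigidityLrcModEntireOfJets
import Summits.NavierStokesRegularity.NavierStokesRegularity.Theorems.PoloidalWindowDoorPoloidalWindowRigidityStructureFunction

/-!
# SKELETON `slope-split` (v1) — item `LrcModEntire` (stmt-NavierStokesRegularity-20428 = the promoted stub of crux K2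
# `PoloidalWindowRigidity`, stmt-19708), route `PoloidalWindowDoor`
# (lead of item 20428: ns-poloidal-K2-p3 g5, 2026-08-27, per DIRECTOR-NS g8 #38 (a); K2 lead of record on 19708: ns-poloidal-K2-p1 g5,
#  skeleton lrc-jet v4)

`LrcModEntire` (VERBATIM the v3 stub `stub_lrcModEntire`: LRC″ with spatial pins modulo entire unbounded germs, for profiles of
the route's Type-I class poloidal along `e₃`) carries NO singularity hypothesis, so the K2 lead's v4 split of 19708 — whose
(TH) stub concludes `¬ IsBackwardSingularPoint` and composes BY CONTRADICTION with the assumed singularity — does not compose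
into THIS item.  The split here is the same PARTITION BY THE DEPENDENCE OF THE SHEAR SLOPE `μ = ∂₂v_b/∂_b v₂`
(`= 1 − 1/Λ`), but with both halves in GERM currency:

* `stub_timeHeightShearGerm` — (TH): on a nonempty open non-degenerate `W` where the slope is a function of `(t, x₂)` and of
  `t` alone on no open subset, SOME slice carries on a nonempty open set a translation germ / a vertical-axis rotation germ of
  the vorticity / agrees with an entire real-analytic field unbounded on `ℝ³` (= LRC″ restricted to (TH)).  Inputs in the
  tree: the (TH) pressure law (K2 lead g5, p530500 `…TimeHeightShearPressure`), the (TH) normal form (ns-poloidal-K2-p2 g4,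
  `…TimeHeightShearNormalForm`), and the LINEAR slice structure `θ_zz + μ(t,z)Δ_hθ = 0`, `θ = v₂` (K2-p2 g4 TH-STEP2 §3(i));
  K2-p2 g4's census TH-STEP2 §3: the (TV)/M12 chain yields only large-scale horizontal homogenisation on (TH), so this stub
  is NOT the v4 stub in disguise — it asks for the LOCAL symmetry (structural/tower route, TH-STEP2 §5: the first dynamic
  compatibility condition R_TH is quasilinear of order 4 with principal part `−4μ_z(1−μ)⁸Δ_h²φ`) or an explicit unbounded
  entire family (refuter1's K-a″ restricted to (TH)).  A proof of v4's `stub_timeHeightShear` in the STRONGER currency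
  `v ≡ 0` would also close it (then `curl v = 0` contradicts non-degeneracy on `W`).
* `stub_lrcGeneric` — the THICK stratum, VERBATIM the K2 lead's v4 stub (same name, same signature: ONE landing closes it in
  both skeletons): slope a function of `(t, x₂)` on no open subset (`∇_h Λ ≢ 0` locally) ⇒ the germ trichotomy.
  Research-sized (structural route: this seat's `…StructureFunction` p531376 = normal-form step (d)/(e) `v₂ = F(t,ψ,x₂)`,
  `ψ = A(t,q,x₂)`; K2 lead g5 STRUCT-NOTES (first cutting equation, invariant form); cert-1 / nsreg-p7 exact rigidity at the
  symmetric strata; this seat's pointwise reduction `…LrcModEntireOfJets` p528414 turns it into all-orders Killing jets at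
  points with `∇_h μ ≠ 0`).
* `LrcModEntire_of_slopeSplit` — COMPOSITION (proved, no singularity used): on an admissible `W`, either the slope is a
  function of `(t,x₂)` on some nonempty open `W₁ ⊆ W` (then `W₁` is admissible for the (TH) stub: non-degeneracy and the
  time-pin restrict to subsets) or it is so on no open subset (the thick stub applies to `W` itself).

Crux K2 (19708) from this item is KERNEL-COMPLETE (v3's `lrcSpatial_of_stubs` + `…TimeShearClosed`; or in one line
`…LrcModEntireOfJets`-style: `…TimeShearClosed.nonflatLiouville_of_lrcSpatial` after killing the entire leg with `…EntireGerm`).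

WHAT THIS IS NOT: not a proof of `LrcModEntire` or of K2 — a registered two-stub partition of the promoted item; both stubs
are research-sized as germ statements ((TH): no mechanism in hand, TH-STEP2 §4; thick: Cartan–Kähler-sized, CENSUS-K2-g4 §4(a)).
-/

-- the summit and its single sub-problem share the name (CONVENTIONS §1)
set_option linter.dupNamespace false

namespace Summit.NavierStokesRegularity.NavierStokesRegularity.Theses.PoloidalWindowDoor

open Set Function
open scoped RealInnerProductSpace InnerProductSpace
open Literature.Analysis Literature.Analysis.FluidPDE
open Summit.NavierStokesRegularity.NavierStokesRegularity.Theorems.PoloidalWindowDoorPoloidalWindowRigidityEntireGerm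

/-- **STUB (TH), GERM CURRENCY — LRC″ modulo entire unbounded germs ON THE TIME–HEIGHT STRATUM.**  For a profile of the
route's Type-I class, poloidal along `e₃`: if on some nonempty open space–time subset `W` of the backward slab the profile is
non-degenerate (`curl v ≠ 0`, `∇_h v₂ ≠ 0`, `∂₂v_h ≠ 0` pointwise), its shear slope is a function of time ALONE on no nonempty
open subset of `W`, and its shear slope IS a function of time and height on `W` (`∂₂v_b(s,y) = m(s, y₂) ∂_b v₂(s,y)`,
`b = 0,1`), then there are a slice `s < 0` and a nonempty open `U ⊆ ℝ³` on which EITHER the vorticity carries an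
infinitesimal horizontal Killing symmetry (translation germ `D(curl v(s))(y)[e] = 0`, `e ≠ 0`, or rotation germ about a
vertical axis `J curl v(s)(y) = D(curl v(s))(y)[J(y − c)]`), OR the slice `v(s)` agrees on `U` with an ENTIRE real-analytic
field whose norm is unbounded on `ℝ³`.  (Hypotheses = VERBATIM those of the K2 lead's v4 `stub_timeHeightShear`; conclusion =
the germ trichotomy of `LrcModEntire` instead of `¬ IsBackwardSingularPoint`.) -/
theorem stub_timeHeightShearGerm :
    ∀ (C : ℝ) (v : ℝ → EuclideanSpace ℝ (Fin 3) → EuclideanSpace ℝ (Fin 3)),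
      Literature.Analysis.FluidPDE.HasTypeITimeDecay C v →
      ContinuousOn (Function.uncurry v) (Set.Iio (0 : ℝ) ×ˢ Set.univ) →
      (∀ s t : ℝ, s < t → t < 0 → ∀ x, v t x =
        Literature.Analysis.UnboundedOperators.heatExtension (v s) (t - s) x -
          Literature.Analysis.FluidPDE.oseenDuhamel 1 s v v t x) →
      (∀ t < 0, Literature.Analysis.FluidPDE.VectorCalculus.IsDivFree (v t)) →
      (∀ s < 0, ∀ y, ⟪Literature.Analysis.FluidPDE.curl (v s) y, EuclideanSpace.single 2 1⟫_ℝ = 0) →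
      ∀ W : Set (ℝ × EuclideanSpace ℝ (Fin 3)), IsOpen W → W.Nonempty → W ⊆ Set.Iio (0 : ℝ) ×ˢ Set.univ →
        (∀ z ∈ W, Literature.Analysis.FluidPDE.curl (v z.1) z.2 ≠ 0 ∧
          (fderiv ℝ (v z.1) z.2 (EuclideanSpace.single 0 1) 2 ≠ 0 ∨ fderiv ℝ (v z.1) z.2 (EuclideanSpace.single 1 1) 2 ≠ 0) ∧
          (fderiv ℝ (v z.1) z.2 (EuclideanSpace.single 2 1) 0 ≠ 0 ∨ fderiv ℝ (v z.1) z.2 (EuclideanSpace.single 2 1) 1 ≠ 0)) →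
        (∀ m : ℝ → ℝ, ∀ W₁ : Set (ℝ × EuclideanSpace ℝ (Fin 3)), W₁ ⊆ W → IsOpen W₁ → W₁.Nonempty →
          ∃ z ∈ W₁, ∃ b : Fin 3, b ≠ 2 ∧
            fderiv ℝ (v z.1) z.2 (EuclideanSpace.single 2 1) b ≠
              m z.1 * fderiv ℝ (v z.1) z.2 (EuclideanSpace.single b 1) 2) →
        (∃ m : ℝ → ℝ → ℝ, ∀ z ∈ W, ∀ b : Fin 3, b ≠ 2 →
          fderiv ℝ (v z.1) z.2 (EuclideanSpace.single 2 1) b =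
            m z.1 (z.2 2) * fderiv ℝ (v z.1) z.2 (EuclideanSpace.single b 1) 2) →
        ∃ s : ℝ, s < 0 ∧ ∃ U : Set (EuclideanSpace ℝ (Fin 3)), IsOpen U ∧ U.Nonempty ∧
          ((∃ e : EuclideanSpace ℝ (Fin 3), e ≠ 0 ∧ ∀ y ∈ U, fderiv ℝ (Literature.Analysis.FluidPDE.curl (v s)) y e = 0) ∨
           (∃ c : EuclideanSpace ℝ (Fin 3), ∀ y ∈ U,
              Literature.Analysis.FluidPDE.rotGen (Literature.Analysis.FluidPDE.curl (v s) y) =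
                fderiv ℝ (Literature.Analysis.FluidPDE.curl (v s)) y (Literature.Analysis.FluidPDE.rotGen (y - c))) ∨
           (∃ w : EuclideanSpace ℝ (Fin 3) → EuclideanSpace ℝ (Fin 3), AnalyticOnNhd ℝ w Set.univ ∧
              ¬ BddAbove (Set.range fun y => ‖w y‖) ∧ ∀ y ∈ U, v s y = w y)) := by
  sorry

/-- **STUB LRC″ ON THE THICK STRATUM, MODULO ENTIRE UNBOUNDED FIELDS (research-sized; v4).**  For a profile of the
route's Type-I class, poloidal along `e₃`: on every nonempty open space–time subset `W` of the backward slab on which the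
profile is non-degenerate (`curl v ≠ 0`, `∇_h v₂ ≠ 0`, `∂₂v_h ≠ 0` pointwise) and on which the shear slope is a function of
`(t, x₂)` on NO nonempty open subset (the Clebsch slope varies across vortex lines), there are a slice `s < 0` and a
nonempty open `U ⊆ ℝ³` such that EITHER the vorticity carries an infinitesimal horizontal Killing symmetry on `U`
(translation germ `D(curl v(s))(y)[e] = 0`, `e ≠ 0`, or rotation germ about a vertical axis
`J curl v(s)(y) = D(curl v(s))(y)[J(y − c)]`), OR the slice `v(s)` agrees on `U` with an ENTIRE real-analytic field whose
norm is unbounded on `ℝ³` (absurd in the class, `…EntireGerm`).  This is v3's `stub_lrcModEntire` restricted to the thick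
stratum; its pin implies v3's (a function of `t` is a function of `(t,x₂)`). -/
theorem stub_lrcGeneric :
    ∀ (C : ℝ) (v : ℝ → EuclideanSpace ℝ (Fin 3) → EuclideanSpace ℝ (Fin 3)),
      Literature.Analysis.FluidPDE.HasTypeITimeDecay C v →
      ContinuousOn (Function.uncurry v) (Set.Iio (0 : ℝ) ×ˢ Set.univ) →
      (∀ s t : ℝ, s < t → t < 0 → ∀ x, v t x =
        Literature.Analysis.UnboundedOperators.heatExtension (v s) (t - s) x -
          Literature.Analysis.FluidPDE.oseenDuhamel 1 s v v t x) →
      (∀ t < 0, Literature.Analysis.FluidPDE.VectorCalculus.IsDivFree (v t)) →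
      (∀ s < 0, ∀ y, ⟪Literature.Analysis.FluidPDE.curl (v s) y, EuclideanSpace.single 2 1⟫_ℝ = 0) →
      ∀ W : Set (ℝ × EuclideanSpace ℝ (Fin 3)), IsOpen W → W.Nonempty → W ⊆ Set.Iio (0 : ℝ) ×ˢ Set.univ →
        (∀ z ∈ W, Literature.Analysis.FluidPDE.curl (v z.1) z.2 ≠ 0 ∧
          (fderiv ℝ (v z.1) z.2 (EuclideanSpace.single 0 1) 2 ≠ 0 ∨ fderiv ℝ (v z.1) z.2 (EuclideanSpace.single 1 1) 2 ≠ 0) ∧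
          (fderiv ℝ (v z.1) z.2 (EuclideanSpace.single 2 1) 0 ≠ 0 ∨ fderiv ℝ (v z.1) z.2 (EuclideanSpace.single 2 1) 1 ≠ 0)) →
        (∀ m : ℝ → ℝ → ℝ, ∀ W₁ : Set (ℝ × EuclideanSpace ℝ (Fin 3)), W₁ ⊆ W → IsOpen W₁ → W₁.Nonempty →
          ∃ z ∈ W₁, ∃ b : Fin 3, b ≠ 2 ∧
            fderiv ℝ (v z.1) z.2 (EuclideanSpace.single 2 1) b ≠
              m z.1 (z.2 2) * fderiv ℝ (v z.1) z.2 (EuclideanSpace.single b 1) 2) →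
        ∃ s : ℝ, s < 0 ∧ ∃ U : Set (EuclideanSpace ℝ (Fin 3)), IsOpen U ∧ U.Nonempty ∧
          ((∃ e : EuclideanSpace ℝ (Fin 3), e ≠ 0 ∧ ∀ y ∈ U, fderiv ℝ (Literature.Analysis.FluidPDE.curl (v s)) y e = 0) ∨
           (∃ c : EuclideanSpace ℝ (Fin 3), ∀ y ∈ U,
              Literature.Analysis.FluidPDE.rotGen (Literature.Analysis.FluidPDE.curl (v s) y) =
                fderiv ℝ (Literature.Analysis.FluidPDE.curl (v s)) y (Literature.Analysis.FluidPDE.rotGen (y - c))) ∨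
           (∃ w : EuclideanSpace ℝ (Fin 3) → EuclideanSpace ℝ (Fin 3), AnalyticOnNhd ℝ w Set.univ ∧
              ¬ BddAbove (Set.range fun y => ‖w y‖) ∧ ∀ y ∈ U, v s y = w y)) := by
  sorry

/-- **COMPOSITION (proved, no singularity hypothesis): `LrcModEntire` from the two stubs.**  On an admissible `W`
(non-degenerate, slope a function of time alone on no open subset): if the slope is a function of `(t, x₂)` on some
nonempty open `W₁ ⊆ W`, apply `stub_timeHeightShearGerm` to `W₁` (non-degeneracy and the time-pin restrict to `W₁`);
otherwise apply `stub_lrcGeneric` to `W`. -/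
theorem LrcModEntire_of_slopeSplit : LrcModEntire := by
  intro C v hrate hcont hmild hdiv hpol W hW hWne hWs hnd hpin
  by_cases hTH : ∃ m : ℝ → ℝ → ℝ, ∃ W₁ : Set (ℝ × EuclideanSpace ℝ (Fin 3)), W₁ ⊆ W ∧ IsOpen W₁ ∧ W₁.Nonempty ∧
      ∀ z ∈ W₁, ∀ b : Fin 3, b ≠ 2 →
        fderiv ℝ (v z.1) z.2 (EuclideanSpace.single 2 1) b =
          m z.1 (z.2 2) * fderiv ℝ (v z.1) z.2 (EuclideanSpace.single b 1) 2
  · obtain ⟨m, W₁, hW₁W, hW₁, hW₁ne, hid⟩ := hTH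
    exact stub_timeHeightShearGerm C v hrate hcont hmild hdiv hpol W₁ hW₁ hW₁ne (hW₁W.trans hWs)
      (fun z hz => hnd z (hW₁W hz)) (fun m' W₂ hW₂ hW₂o hW₂ne => hpin m' W₂ (hW₂.trans hW₁W) hW₂o hW₂ne) ⟨m, hid⟩
  · push Not at hTH
    have hpin2 : ∀ m : ℝ → ℝ → ℝ, ∀ W₁ : Set (ℝ × EuclideanSpace ℝ (Fin 3)), W₁ ⊆ W → IsOpen W₁ → W₁.Nonempty →
        ∃ z ∈ W₁, ∃ b : Fin 3, b ≠ 2 ∧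
          fderiv ℝ (v z.1) z.2 (EuclideanSpace.single 2 1) b ≠
            m z.1 (z.2 2) * fderiv ℝ (v z.1) z.2 (EuclideanSpace.single b 1) 2 := by
      intro m W₁ h1 h2 h3
      obtain ⟨z, hz, b, hb, hne⟩ := hTH m W₁ h1 h2 h3
      exact ⟨z, hz, b, hb, hne⟩
    exact stub_lrcGeneric C v hrate hcont hmild hdiv hpol W hW hWne hWs hnd hpin2

/-- **Crux K2 from this item's skeleton (proved modulo the two stubs; no new content)** — the one-line route
`LrcModEntire ⇒ (pointwise-free) hLRC ⇒ K2` through this seat's `…LrcModEntireOfJets`-style composition is already in the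
tree for the v3 signature; here we only record that `LrcModEntire_of_slopeSplit` feeds the K2 lead's skeleton
(`Lines/lrc_jet.lean`, `lrcSpatial_of_stubs`) verbatim, since `LrcModEntire` IS the v3 stub. -/
theorem lrcModEntire_holds_of_slopeSplit :
    ∀ (C : ℝ) (v : ℝ → EuclideanSpace ℝ (Fin 3) → EuclideanSpace ℝ (Fin 3)),
      Literature.Analysis.FluidPDE.HasTypeITimeDecay C v →
      ContinuousOn (Function.uncurry v) (Set.Iio (0 : ℝ) ×ˢ Set.univ) →
      (∀ s t : ℝ, s < t → t < 0 → ∀ x, v t x =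
        Literature.Analysis.UnboundedOperators.heatExtension (v s) (t - s) x -
          Literature.Analysis.FluidPDE.oseenDuhamel 1 s v v t x) →
      (∀ t < 0, Literature.Analysis.FluidPDE.VectorCalculus.IsDivFree (v t)) →
      (∀ s < 0, ∀ y, ⟪Literature.Analysis.FluidPDE.curl (v s) y, EuclideanSpace.single 2 1⟫_ℝ = 0) →
      ¬ Literature.Analysis.FluidPDE.IsBackwardSingularPoint v 0 := by
  intro C v hrate hcont hmild hdiv hpol
  refine Summit.NavierStokesRegularity.NavierStokesRegularity.Theorems.PoloidalWindowDoorPoloidalWindowRigidityTimeShearClosed.nonflatLiouville_of_lrcSpatial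
    hrate hcont hmild hdiv hpol ?_
  intro W hW hWne hWs hnd hpin
  obtain ⟨s, hs, U, hU, hUne, halt⟩ := LrcModEntire_of_slopeSplit C v hrate hcont hmild hdiv hpol W hW hWne hWs hnd hpin
  rcases halt with htr | hrot | ⟨w, hw, hunb, heq⟩
  · exact ⟨s, hs, U, hU, hUne, Or.inl htr⟩
  · exact ⟨s, hs, U, hU, hUne, Or.inr hrot⟩
  · exact absurd heq (not_slice_eqOn_open_of_not_bddAbove hrate hcont hmild hs hw hunb hU hUne)

end Summit.NavierStokesRegularity.NavierStokesRegularity.Theses.PoloidalWindowDoor
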